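import Summits.AtomisticToContinuum.HydrodynamicLimit.Theorems.OneFlightGossipEngineEquilibriumClampedCollisionalWindowLDDefs
import Literature.Analysis.FluidPDE.LocalForecastCorrector

/-!
# Rung R8 of line `Sketch` — the window transfer activity is own-path determined
# (crux `TwoClocks.ClampedTransferWindowLD`, stmt-AtomisticToContinuum-16623)

Helper file (`--supports stmt-AtomisticToContinuum-16623`) of the line lead, proving the registered stub
`SketchLine.stub_activityLocality` (R8 of the lead-owned skeleton `Cruxes/ClampedTransferWindowLD/Lines/Sketch.lean`, v4;
card `Ideas/clamp-price-static-shell.md` §(5), `ActivityLocality`).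

The window TRANSFER ACTIVITY `act_i = (σ/τ) Σ_{records c of i in (0, w]} (‖v⁺ − v⁻‖ + |‖v⁺‖² − ‖v⁻‖²|/2)` of particle `i`
(`ClampedTransferCoin.runAct`) is a functional of the PATH `t ↦ (x_i(t), v_i(t))` of `i` alone: on a good orbit of a hard-sphere
flow on `𝕋³` the records with first particle `m` in `(0, w]` sit at the collision times of `m`, one per time (binary collisions,
`IsHardSphereTrajectory.contactPairs_eq_pair`), with `v⁺ = v_m(t)` and `v⁻ = v_m(t⁻)` the left limit
(`IsHardSphereTrajectory.ofConfig_preVel_eq_leftLim`); at every other time `v_m(t) = v_m(t⁻)` (free flight off the collision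
times, `leftLim_eq_of_not_mem`; a collision of another pair does not touch `m`, `collidePair_apply_of_ne`), where the summand
vanishes. Hence (`collisionSum_ite_fst_eq_finsum`)

  `Σ_{records c, c.fst = m} J(v⁺, v⁻) = Σᶠ_{t ∈ S} J(v_m(t), v_m(t⁻))`   for every `J` with `J(v, v) = 0`.

Two hard-sphere trajectories (of possibly different particle numbers) in which two particles have the same path on `[0, w]`
have the same left limits at every `t ∈ (0, w]` (`leftLim_apply_eq_of_eqOn_Icc`), hence the same own-path sums on `(0, w]`
(`collisionSum_ite_fst_eq_of_eqOn_Icc`). Applied to the orbit of `z` under `Φ` and to the ISOLATED run of the range-`R` cluster of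
`i` (`Literature.Analysis.FluidPDE.localClusterState` = `clusterStateIn` = the cluster flow on the restricted datum,
`clusterStateIn_of_mem_good`) this is the stub: if the isolated cluster run reproduces `i`'s path on `[0, w]`, it reproduces `i`'s
window transfer activity.
-/

noncomputable section

open MeasureTheory ProbabilityTheory Set Filter
open scoped ENNReal BigOperators Topology
open Literature.Analysis.FluidPDE Literature.MathematicalPhysics.KineticTheory
open Literature.Analysis.FunctionSpaces (Torus.partialDeriv Torus.IsSmooth)

namespace Summit.AtomisticToContinuum.HydrodynamicLimit.Theorems.ClampedTransferCoin.SketchLine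

/-! ## Own-path form of a first-particle collision sum along one hard-sphere trajectory -/

section OwnPath

variable {d : Type*} [Fintype d] {X : Type*} [TopologicalSpace X] [T2Space X] {G : Geometry d X} {ε : ℝ}

/-- **Own-path form of a first-particle collision sum.** On a hard-sphere trajectory in a regular geometry with continuous
translations, for every summand `J (v⁺, v⁻)` of the post/pre velocities of the FIRST particle of a record with `J (v, v) = 0`,
the collision sum of `𝟙{fst = m} · J` over the times in `S` is the sum over ALL `t ∈ S` of `J (v_m(t), v_m(t⁻))`
(a `finsum`; the summand vanishes off the collision times of `m`). -/
theorem collisionSum_ite_fst_eq_finsum {M : ℕ} {γ : ℝ → Config M d X} (h : IsHardSphereTrajectory G ε M γ)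
    (hG : G.IsHardSphereRegular ε) (hGc : ∀ x : X, Continuous (G.translate x)) (S : Set ℝ) (m : Fin M)
    (J : EuclideanSpace ℝ d → EuclideanSpace ℝ d → ℝ) (hJ : ∀ v, J v v = 0) :
    collisionSum G ε γ S (fun c => if c.fst = m then J c.postVel.1 c.preVel.1 else 0) =
      ∑ᶠ t ∈ S, J (γ t m).2 (Function.leftLim γ t m).2 := by
  classical
  -- (A) per collision time: the records of `m` contribute `J (v_m(t), v_m(t⁻))`
  have hA : collisionSum G ε γ S (fun c => if c.fst = m then J c.postVel.1 c.preVel.1 else 0) =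
      ∑ᶠ t ∈ collisionTimes G ε γ ∩ S, J (γ t m).2 (Function.leftLim γ t m).2 := by
    rw [collisionSum_eq_collisionPairSum, collisionPairSum]
    refine finsum_mem_congr rfl fun t ht => ?_
    obtain ⟨⟨a, b⟩, hab⟩ := mem_collisionTimes_iff_contactPairs_nonempty.1 ht.1
    have hne : a ≠ b := (mem_contactPairs.1 hab).1
    have hc : γ t ∈ contactSet G M ε a b := (mem_contactPairs.1 hab).2
    have hba : (b, a) ∈ contactPairs G ε (γ t) := (swap_mem_contactPairs_iff hG).2 hab
    rw [h.contactPairs_eq_pair hG hab, Finset.sum_pair (fun he => hne (Prod.mk.inj he).1)]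
    simp only [HardSphereCollisionRecord.ofConfig_fst, HardSphereCollisionRecord.ofConfig_postVel]
    rw [h.ofConfig_preVel_eq_leftLim hab, h.ofConfig_preVel_eq_leftLim hba]
    by_cases hma : a = m
    · subst hma
      rw [if_pos rfl, if_neg (Ne.symm hne), add_zero]
    · by_cases hmb : b = m
      · subst hmb
        rw [if_neg hma, if_pos rfl, zero_add]
      · rw [if_neg hma, if_neg hmb, add_zero]
        have hm : γ t m = Function.leftLim γ t m := by
          conv_lhs => rw [(h.eq_collidePair_leftLim hne hc).2]
          exact collidePair_apply_of_ne (fun e => hma e.symm) (fun e => hmb e.symm) _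
        rw [← hm, hJ]
  -- (B) off the collision times the summand vanishes
  rw [hA]
  refine finsum_mem_inter_support_eq' _ _ _ fun t ht => ⟨fun h' => h'.2, fun h' => ⟨?_, h'⟩⟩
  by_contra hnot
  refine ht ?_
  show J (γ t m).2 (Function.leftLim γ t m).2 = 0
  rw [h.leftLim_eq_of_not_mem hGc hnot, hJ]

/-- **Left limits only see the path.** If particle `i₁` of the hard-sphere trajectory `γ₁` and particle `i₂` of the
hard-sphere trajectory `γ₂` (same geometry, possibly different particle numbers) have the same state on `[0, w]`, then their
left limits agree at every `t ∈ (0, w]`. -/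
theorem leftLim_apply_eq_of_eqOn_Icc {M₁ M₂ : ℕ} {γ₁ : ℝ → Config M₁ d X} {γ₂ : ℝ → Config M₂ d X}
    (h₁ : IsHardSphereTrajectory G ε M₁ γ₁) (h₂ : IsHardSphereTrajectory G ε M₂ γ₂)
    (hGc : ∀ x : X, Continuous (G.translate x)) {i₁ : Fin M₁} {i₂ : Fin M₂} {w : ℝ}
    (heq : ∀ s ∈ Icc 0 w, γ₁ s i₁ = γ₂ s i₂) {t : ℝ} (ht : t ∈ Ioc 0 w) :
    Function.leftLim γ₁ t i₁ = Function.leftLim γ₂ t i₂ := by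
  have hl₁ : Tendsto (fun s => γ₁ s i₁) (𝓝[<] t) (𝓝 (Function.leftLim γ₁ t i₁)) :=
    ((continuous_apply i₁).tendsto _).comp (h₁.tendsto_leftLim hGc t)
  have hl₂ : Tendsto (fun s => γ₂ s i₂) (𝓝[<] t) (𝓝 (Function.leftLim γ₂ t i₂)) :=
    ((continuous_apply i₂).tendsto _).comp (h₂.tendsto_leftLim hGc t)
  have hev : (fun s => γ₁ s i₁) =ᶠ[𝓝[<] t] fun s => γ₂ s i₂ := by
    filter_upwards [Ioo_mem_nhdsLT ht.1] with s hs
    exact heq s ⟨hs.1.le, hs.2.le.trans ht.2⟩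
  exact tendsto_nhds_unique (hl₁.congr' hev) hl₂

/-- **Own-path determination of first-particle collision sums.** Two hard-sphere trajectories in which two particles have the
same path on `[0, w]` have the same collision sums of `𝟙{fst = ·} · J (v⁺, v⁻)` over `(0, w]`, for every `J` with `J (v, v) = 0`. -/
theorem collisionSum_ite_fst_eq_of_eqOn_Icc {M₁ M₂ : ℕ} {γ₁ : ℝ → Config M₁ d X} {γ₂ : ℝ → Config M₂ d X}
    (h₁ : IsHardSphereTrajectory G ε M₁ γ₁) (h₂ : IsHardSphereTrajectory G ε M₂ γ₂)
    (hG : G.IsHardSphereRegular ε) (hGc : ∀ x : X, Continuous (G.translate x)) {i₁ : Fin M₁} {i₂ : Fin M₂} {w : ℝ}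
    (heq : ∀ s ∈ Icc 0 w, γ₁ s i₁ = γ₂ s i₂)
    (J : EuclideanSpace ℝ d → EuclideanSpace ℝ d → ℝ) (hJ : ∀ v, J v v = 0) :
    collisionSum G ε γ₁ (Ioc 0 w) (fun c => if c.fst = i₁ then J c.postVel.1 c.preVel.1 else 0) =
      collisionSum G ε γ₂ (Ioc 0 w) (fun c => if c.fst = i₂ then J c.postVel.1 c.preVel.1 else 0) := by
  rw [collisionSum_ite_fst_eq_finsum h₁ hG hGc _ i₁ J hJ, collisionSum_ite_fst_eq_finsum h₂ hG hGc _ i₂ J hJ]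
  refine finsum_mem_congr rfl fun t ht => ?_
  rw [heq t ⟨ht.1.le, ht.2⟩, leftLim_apply_eq_of_eqOn_Icc h₁ h₂ hGc heq ht]

end OwnPath

/-! ## The registered stub -/

/-- **R8 · activity locality** (registered stub `stub_activityLocality` of line `Sketch`): if the isolated run of the range-`R`
cluster of `i` reproduces the path of `i` on the window `[0, w]`, it reproduces the window transfer activity of `i`:
`act_i(z) = (σ/τ) Σ_{records c of the cluster run with c.fst = (label of i), c.time ∈ (0, w]} (‖v⁺ − v⁻‖ + |‖v⁺‖² − ‖v⁻‖²|/2)`. -/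
theorem stub_activityLocality :
    ∀ (σ τ R : ℝ) (N : ℕ), 0 < σ → 0 < τ → hsDiameter σ N < 2⁻¹ →
      ∀ (Φ : Flow σ N) (Ψs : (k : ℕ) → HardSphereFlow (Torus.geometry (Fin 3)) (hsDiameter σ N) k)
        (i : Fin (N + 1)) (z : Phase N), z ∈ Φ.good →
        Config.restrictTo (rangeCluster (Torus.geometry (Fin 3)) R z i) z ∈
          (Ψs (rangeCluster (Torus.geometry (Fin 3)) R z i).card).good →
        (∀ t ∈ Set.Icc 0 (window τ N), Φ.flow t z i = localClusterState Ψs R t z i) →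
        runAct σ τ Φ (window τ N) i z =
          σ / τ * (Ψs (rangeCluster (Torus.geometry (Fin 3)) R z i).card).collisionSum (Set.Ioc 0 (window τ N))
            (fun c => if c.fst = clusterIndex (rangeCluster (Torus.geometry (Fin 3)) R z i) i
                (self_mem_rangeCluster (Torus.geometry (Fin 3)) R z i)
              then ‖c.postVel.1 - c.preVel.1‖ + |‖c.postVel.1‖ ^ 2 - ‖c.preVel.1‖ ^ 2| / 2 else 0)
            (Config.restrictTo (rangeCluster (Torus.geometry (Fin 3)) R z i) z) := by
  intro σ τ R N _hσ _hτ hε Φ Ψs i z hz hy hpath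
  have hG : (Torus.geometry (Fin 3)).IsHardSphereRegular (hsDiameter σ N) := Torus.isHardSphereRegular_geometry hε
  have hGc : ∀ x : T3, Continuous ((Torus.geometry (Fin 3)).translate x) := Torus.continuous_geometry_translate
  have hpath' : ∀ t ∈ Icc 0 (window τ N), Φ.flow t z i =
      (Ψs (rangeCluster (Torus.geometry (Fin 3)) R z i).card).flow t
        (Config.restrictTo (rangeCluster (Torus.geometry (Fin 3)) R z i) z)
        (clusterIndex (rangeCluster (Torus.geometry (Fin 3)) R z i) i
          (self_mem_rangeCluster (Torus.geometry (Fin 3)) R z i)) := fun t ht => by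
    rw [hpath t ht, localClusterState, clusterStateIn_of_mem_good Ψs _ t hy]
  have key := collisionSum_ite_fst_eq_of_eqOn_Icc (Φ.isTrajectory z hz) ((Ψs _).isTrajectory _ hy) hG hGc hpath'
    (fun v w : V3 => ‖v - w‖ + |‖v‖ ^ 2 - ‖w‖ ^ 2| / 2) (fun v => by simp)
  beta_reduce at key
  rw [runAct, HardSphereFlow.collisionSum_eq, HardSphereFlow.collisionSum_eq]
  simp only [impulse]
  rw [key]

end Summit.AtomisticToContinuum.HydrodynamicLimit.Theorems.ClampedTransferCoin.SketchLine

end
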